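import Literature.NumberTheory.Rogawski1990.SingularObstruction
import HarnessLib

/-!
# The singular κ-weight `W([δ]) = (−1)^{obs_s δ}` EXISTS on the adelic conjugacy classes of a split semisimple stable class
(Rogawski, *Automorphic Representations of Unitary Groups in Three Variables* (1990), §4.3 p. 44 «`Φ^κ(γ, f) = Σ_δ κ(obs δ) Φ(δ, f)`», §5.4
(5.4.2)–(5.4.3) pp. 72–73, §14.5 Lemma 14.5.2 (b) pp. 238–239; Kottwitz, *Stable trace formula: elliptic singular terms*, Math. Ann. 275 (1986), §9)

Topic `NumberTheory/Rogawski1990`; namespace `Literature.NumberTheory.Rogawski1990`; THEOREMS ONLY (no definition, no instance, no notation, no named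
fact, no `sorry`).  Singular twin «(i)-W-s» of ★ `CartanObstructionClassWeight` (the regular `χ ≠ 1` class weights): the count ★
`MatchingAdeleG₂.stableOrbitalSum_map_toAdelic_eq_half_of_singularObs` (`PreStabilisationSingularSelf`), its kit-currency form ★
`adelicStableOrbitalIntegral_ofLocal_stableClassOf_eq_half_of_singularObs` and the κ-half pin of the T1b identity at a singular class all read the weight
`W : ConjClasses U(H)(𝐀) → ℂ` with `hW : W [q.adele] = if obs_s q = 0 then 1 else −1` as HYPOTHESES; here such a `W` is shown to EXIST (def-free `∃`), because
★ `MatchingAdeleG₂.singularObs_eq_of_isConjAdele` makes `q ↦ obs_s q` constant on `U(H)(𝐀)`-classes.  Cell hodgecm-mathlib, FLOOR-0 programme P3a, row O7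
(T1b at the non-regular classes); HC_CM is proved only modulo the printed citations until rung 0 closes.

* `MatchingAdeleG₂.singularObs_eq_of_mk_adele_eq` — `obs_s` depends only on the class `[q.adele]`.
* **`MatchingAdeleG₂.exists_singularClassWeight`** — `∃ W : ConjClasses U(H)(𝐀) → ℂ, ∀ q, W [q.adele] = if obs_s q = 0 then 1 else −1` (off the matching classes
  `W` is `0` — junk, never read).

## References
* J. D. Rogawski, *Automorphic Representations of Unitary Groups in Three Variables*, Ann. of Math. Stud. 123 (1990), §4.3 p. 44, §5.4 pp. 72–73, §14.5
  pp. 238–239 [Rogawski1990].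
* R. E. Kottwitz, *Stable trace formula: elliptic singular terms*, Math. Ann. 275 (1986), 365–399, §9 [Kottwitz1986].
-/

set_option autoImplicit false

noncomputable section

open NumberField IsDedekindDomain
open scoped Matrix MatrixGroups

namespace Literature.NumberTheory.Rogawski1990

open Literature.NumberTheory.Automorphic
open Literature.AlgebraicGeometry.ShimuraVarieties (unitaryGroup)

section SingularClassWeight

variable {L : Type} [Field L] [NumberField L] [IsCMField L] {H : Matrix (Fin 3) (Fin 3) L} {γ₀ : (UnitaryGroup.cmDatum L 3 H).Rational}
  {a b : L}

/-- **`obs_s` is a class function**: matching adèles with the same `U(H)(𝐀)`-class have the same singular obstruction (★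
`MatchingAdeleG₂.singularObs_eq_of_isConjAdele`, ★ `MatchingAdeleG₂.isConjAdele_iff_mk_eq_mk`). [cite: Rogawski1990, §3.3 (3.3.1) p. 22; §5.4 p. 72]
[cite: Kottwitz1986, §9] -/
theorem MatchingAdeleG₂.singularObs_eq_of_mk_adele_eq (hHd : IsUnit H.det) (hab : a ≠ b) (ha : a * cmConjRingHom L a = 1)
    (hb : b * cmConjRingHom L b = 1)
    (hγ₀ : ((((γ₀ : unitaryGroup (cmConjRingHom L) H).val : GL (Fin 3) L) : Matrix (Fin 3) (Fin 3) L) - a • (1 : Matrix (Fin 3) (Fin 3) L)) *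
      ((((γ₀ : unitaryGroup (cmConjRingHom L) H).val : GL (Fin 3) L) : Matrix (Fin 3) (Fin 3) L) - b • (1 : Matrix (Fin 3) (Fin 3) L)) = 0)
    {p q : MatchingAdeleG₂ L H H γ₀} (h : ConjClasses.mk p.adele = ConjClasses.mk q.adele) :
    p.singularObs hab hγ₀ = q.singularObs hab hγ₀ :=
  MatchingAdeleG₂.singularObs_eq_of_isConjAdele hHd hab ha hb hγ₀ (MatchingAdeleG₂.isConjAdele_iff_mk_eq_mk.2 h)

/-- **THE SINGULAR κ-WEIGHT EXISTS**: at a split semisimple `γ₀` (`(γ₀ − a)(γ₀ − b) = 0`, `a ≠ b` of norm one) there is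
`W : ConjClasses U(H)(𝐀) → ℂ` with `W [q.adele] = if obs_s q = 0 then 1 else −1` for every matching adèle `q` — the hypothesis `(W, hW)` of ★
`MatchingAdeleG₂.stableOrbitalSum_map_toAdelic_eq_half_of_singularObs` and of the κ-half of [Lemma 14.5.2 (b)] (`W c := ±1` by `obs_s q` for any matching `q`
with `[q.adele] = c`, well defined by `singularObs_eq_of_mk_adele_eq`; `0` off the matching classes). [cite: Rogawski1990, §4.3 p. 44; §5.4 (5.4.3) pp. 72–73;
§14.5 Lemma 14.5.2 (b) p. 238] [cite: Kottwitz1986, §9] -/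
theorem MatchingAdeleG₂.exists_singularClassWeight (hHd : IsUnit H.det) (hab : a ≠ b) (ha : a * cmConjRingHom L a = 1)
    (hb : b * cmConjRingHom L b = 1)
    (hγ₀ : ((((γ₀ : unitaryGroup (cmConjRingHom L) H).val : GL (Fin 3) L) : Matrix (Fin 3) (Fin 3) L) - a • (1 : Matrix (Fin 3) (Fin 3) L)) *
      ((((γ₀ : unitaryGroup (cmConjRingHom L) H).val : GL (Fin 3) L) : Matrix (Fin 3) (Fin 3) L) - b • (1 : Matrix (Fin 3) (Fin 3) L)) = 0) :
    ∃ W : ConjClasses (UnitaryGroup.cmDatum L 3 H).Adelic → ℂ,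
      ∀ q : MatchingAdeleG₂ L H H γ₀, W (ConjClasses.mk q.adele) = if q.singularObs hab hγ₀ = 0 then 1 else -1 := by
  classical
  refine ⟨fun c => if h : ∃ q : MatchingAdeleG₂ L H H γ₀, ConjClasses.mk q.adele = c
    then (if h.choose.singularObs hab hγ₀ = 0 then 1 else -1) else 0, fun q => ?_⟩
  have h : ∃ q' : MatchingAdeleG₂ L H H γ₀, ConjClasses.mk q'.adele = ConjClasses.mk q.adele := ⟨q, rfl⟩
  simp only [dif_pos h]
  rw [MatchingAdeleG₂.singularObs_eq_of_mk_adele_eq hHd hab ha hb hγ₀ h.choose_spec]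

end SingularClassWeight

end Literature.NumberTheory.Rogawski1990

end
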